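import Summits.QuantumFields.BalabanUV.Beta.EriceRemainderEnclosureHistoryAutonomyComparisonDefectInfiniteMemory
import Summits.QuantumFields.BalabanUV.Beta.EriceFlowEnclosureB12AsPrintedHistoryContagionShiftFlowZeroAutonomy
import Mathlib.Analysis.SpecificLimits.Normed

/-!
# EriceRemainderEnclosureHistoryAutonomyComparisonDefectMemoryProfile — (E140o) **THE JUNCTION WITH NODE U2'S `MemoryProfile`: an ISOTONE functional with a geometric
# memory profile in the couplings, a floor and a ceiling encloses every sign-free `ε`-remainder, K-free and depth-free.**  Node U2's hypothesis shape
# `T4BetaStationary.MemoryProfile Cm θ γ B` (`|B h − B h′| ≤ Cm·Σ' j, θ^j·|h_j − h′_j|` on the box — the β-flow team's standing currency, cf. their part 38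
# `…ContagionShiftFlowZeroAutonomy`) DISCHARGES the two infinite-memory hypotheses of (E140n) `enclosure_infinite`: (W) window level-Lipschitz profiles with the GEOMETRIC
# LEVEL PROFILE `Λ_k = Cm·γ³·θ^k` (`window_profile_of_memoryProfile`: isotonicity + `u − v ≤ u³(1∕v² − 1∕u²)`), whose partial age moments are bounded by
# `θ_lev := Cm·γ³·θ∕(1−θ)²` and `θ₂ := Cm·γ³·Σ' k, k²θ^k` (`partial_first_moment_le`, `partial_second_moment_le`), and (T) fading tails `η_K = Cm·γθ^K∕(1−θ) → 0`
# (`tail_of_memoryProfile`); the zeroth moment `Cm∕(1−θ)` is the β-flow team's `zerothMoment_of_memoryProfile` BY NAME.  RESULT (`enclosure_memoryProfile`): if moreover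
# **`θ_lev = Cm·γ³·θ∕(1−θ)² < 1`** (the LEVEL age moment below one — a smallness of the BOX `γ`, not of the memory), then for ANY `B′` with `|B′ − B| ≤ ε` (`0 ≤ ε < b`) and any
# box solutions `h₋, h₊, h′` of `B − ε, B + ε, B′` from one pin:   **`1∕h₋_j² − θ₂·(2ε + θ_lev·2ε∕(1−θ_lev)) ≤ 1∕h′_j² ≤ 1∕h₊_j² + θ₂·(2ε + θ_lev·2ε∕(1−θ_lev))`** at every `j`.

Cell `pub-balaban`, β-function sub-cell, BINDER row D4 «RemainderConst leaves for Bałaban's split» (`HOME/BINDER-OWNERS.md`; owner lineage `b2b-balaban-beta-an4`;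
this file by co-owner #2 lineage `b2b-balaban-beta-d4-p2`, generation 108), β-FLOW TEAM duty (1), FREEZE (0) honoured (def-free; node U2's `MemoryProfile` ∕ `SeqBox` ∕
`summable_profile`, the β-flow team's `zerothMoment_of_memoryProfile` (unit `b2b-balaban-beta-bflow-p1`, part 38) and (E140n) `enclosure_infinite` BY NAME; nothing restated).

HONEST FRAMING (page 1, verbatim and binding).  *"Discharging BetaPertH makes Bałaban's UV stability UNCONDITIONAL — a real constructive-QFT result; it is
NOT the continuum limit and NOT the Clay problem."*  THIS FILE DISCHARGES NOTHING OF THE KIND.  Elementary real analysis (geometric series, coordinatewise maxima) about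
ABSTRACT functionals on a box ]0,γ]^ℕ over node U2's HYPOTHESIS SHAPES; whether Bałaban's (1.22) limit functional is isotone with a memory profile is NOT PRINTED ([I] p. 298;
GAPS G-t4-U2-1∕-2) and NOT asserted.  Row D4 class UNCHANGED (critical-path width 0; instance 0∕1; D4 DISCHARGE NO DATE).  NOT B12 Thm 2, NOT BetaPertH, NOT continuum YM,
NOT Clay.

WHAT IS PROVED ([folklore]; 0 `def`, 0 sorry).  §1 `sub_le_cube_mul_level_gap`, **`window_profile_of_memoryProfile`**, **`tail_of_memoryProfile`**, `partial_first_moment_le`,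
`partial_second_moment_le`.  §2 **`enclosure_memoryProfile`**.
-/

noncomputable section
open Finset Set Filter Topology

namespace Summit.QuantumFields.BalabanUV.Beta.EriceRemainderEnclosureHistoryAutonomyComparisonDefectMemoryProfile

open Literature.MathematicalPhysics.QuantumFieldTheory.Balaban1983to89
open Literature.MathematicalPhysics.QuantumFieldTheory.Balaban1983to89.T4BetaStationary
open Literature.MathematicalPhysics.QuantumFieldTheory.Balaban1983to89.T4BetaFlowWellPosed
open Summit.QuantumFields.BalabanUV.Beta.EriceFlowEnclosureB12AsPrintedHistoryContagionShiftFlowZeroAutonomy (zerothMoment_of_memoryProfile)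
open Summit.QuantumFields.BalabanUV.Beta.EriceRemainderEnclosureHistoryAutonomyComparisonDefectInfiniteMemory (enclosure_infinite)

/-! ## §1 From a memory profile in the couplings to window level profiles, fading tails and bounded age moments -/

/-- COUPLING GAP VS LEVEL GAP: `u − v ≤ u³·(1∕v² − 1∕u²)` for `0 < v ≤ u` — the bridge from a modulus in the COUPLINGS (node U2's `MemoryProfile`) to the column's
LEVEL-Lipschitz profiles. [folklore] -/
theorem sub_le_cube_mul_level_gap {u v : ℝ} (hv : 0 < v) (hvu : v ≤ u) : u - v ≤ u ^ 3 * (1 / v ^ 2 - 1 / u ^ 2) := by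
  have hu : 0 < u := hv.trans_le hvu
  have e : u ^ 3 * (1 / v ^ 2 - 1 / u ^ 2) = (u ^ 3 - u * v ^ 2) / v ^ 2 := by
    field_simp
  rw [e, le_div_iff₀ (pow_pos hv 2)]
  nlinarith [mul_nonneg (sub_nonneg.mpr hvu) (mul_nonneg hu.le hv.le), mul_nonneg (sub_nonneg.mpr hvu) (sq_nonneg (u - v)),
    sq_nonneg v, mul_pos hu hv]

/-- **WINDOW PROFILES FROM A MEMORY PROFILE.**  An ISOTONE functional with node U2's `MemoryProfile Cm θ γ` (`|B h − B h′| ≤ Cm·Σ' j, θ^j|h_j − h′_j|`) is level-Lipschitz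
in its first `K` coordinates, with the GEOMETRIC LEVEL PROFILE `Λ_k = Cm·γ³·θ^k`, whenever the two configurations agree from coordinate `K` on — in (E138)'s one-sided
positive-part shape (pass through the coordinatewise maximum `w = u ∨ v`: `B u ≤ B w` by isotonicity, `B w − B v ≤ Cm Σ_{k<K} θ^k (u_k − v_k)⁺`, and
`(u_k − v_k)⁺ ≤ γ³·(1∕v_k² − 1∕u_k²)⁺`).  No grading is needed (the crude `u³ ≤ γ³`; the graded refinement would give `(1∕γ² + (k+1)b₀)^{−3∕2}`). [folklore] -/
theorem window_profile_of_memoryProfile {B : (ℕ → ℝ) → ℝ} {Cm θ γ : ℝ} (hB : MemoryProfile Cm θ γ B) (hCm : 0 ≤ Cm) (hθ0 : 0 ≤ θ)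
    (hγ : 0 < γ) (hmono : ∀ u v : ℕ → ℝ, SeqBox γ u → SeqBox γ v → (∀ i, u i ≤ v i) → B u ≤ B v) (K : ℕ) :
    ∀ u v : ℕ → ℝ, SeqBox γ u → SeqBox γ v → (∀ k, K ≤ k → u k = v k) →
      B u - B v ≤ ∑ k ∈ range K, (Cm * γ ^ 3 * θ ^ k) * max (1 / v k ^ 2 - 1 / u k ^ 2) 0 := by
  intro u v hu hv hagree
  -- the coordinatewise maximum w
  set w : ℕ → ℝ := fun k => max (u k) (v k) with hw
  have hwbox : SeqBox γ w := fun k => ⟨lt_max_of_lt_left (hu k).1, max_le (hu k).2 (hv k).2⟩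
  have huw : B u ≤ B w := hmono u w hu hwbox fun i => le_max_left _ _
  have hprof := hB w v hwbox hv
  -- the profile sum is finitely supported on range K
  have hzero : ∀ k ∉ range K, θ ^ k * |w k - v k| = 0 := by
    intro k hk
    have hk' : K ≤ k := by simpa using hk
    simp [hw, hagree k hk']
  rw [tsum_eq_sum hzero] at hprof
  have hwv : B w - B v ≤ Cm * ∑ k ∈ range K, θ ^ k * |w k - v k| := (le_abs_self _).trans hprof
  -- coordinatewise: |w_k − v_k| = (u_k − v_k)⁺ ≤ γ³·(1/v_k² − 1/u_k²)⁺
  have hcoord : ∀ k, θ ^ k * |w k - v k| ≤ γ ^ 3 * θ ^ k * max (1 / v k ^ 2 - 1 / u k ^ 2) 0 := by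
    intro k
    have hθk : 0 ≤ θ ^ k := pow_nonneg hθ0 k
    rcases le_or_gt (u k) (v k) with hle | hgt
    · have : w k = v k := by simp [hw, max_eq_right hle]
      rw [this, sub_self, abs_zero, mul_zero]
      exact mul_nonneg (mul_nonneg (pow_nonneg hγ.le 3) hθk) (le_max_right _ _)
    · have hwk : w k = u k := by simp [hw, max_eq_left hgt.le]
      rw [hwk, abs_of_pos (by linarith)]
      have h1 := sub_le_cube_mul_level_gap (hv k).1 hgt.le
      have hu3 : u k ^ 3 ≤ γ ^ 3 := pow_le_pow_left₀ (hu k).1.le (hu k).2 3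
      have hgap : 0 ≤ 1 / v k ^ 2 - 1 / u k ^ 2 := by
        have := one_div_le_one_div_of_le (pow_pos (hv k).1 2) (pow_le_pow_left₀ (hv k).1.le hgt.le 2)
        linarith
      rw [max_eq_left hgap]
      calc θ ^ k * (u k - v k) ≤ θ ^ k * (u k ^ 3 * (1 / v k ^ 2 - 1 / u k ^ 2)) := mul_le_mul_of_nonneg_left h1 hθk
        _ ≤ θ ^ k * (γ ^ 3 * (1 / v k ^ 2 - 1 / u k ^ 2)) :=
            mul_le_mul_of_nonneg_left (mul_le_mul_of_nonneg_right hu3 hgap) hθk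
        _ = γ ^ 3 * θ ^ k * (1 / v k ^ 2 - 1 / u k ^ 2) := by ring
  have hsum : ∑ k ∈ range K, θ ^ k * |w k - v k| ≤ ∑ k ∈ range K, γ ^ 3 * θ ^ k * max (1 / v k ^ 2 - 1 / u k ^ 2) 0 :=
    sum_le_sum fun k _ => hcoord k
  have e : ∑ k ∈ range K, (Cm * γ ^ 3 * θ ^ k) * max (1 / v k ^ 2 - 1 / u k ^ 2) 0
      = Cm * ∑ k ∈ range K, γ ^ 3 * θ ^ k * max (1 / v k ^ 2 - 1 / u k ^ 2) 0 := by
    rw [mul_sum]; refine sum_congr rfl fun k _ => by ring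
  rw [e]
  have := mul_le_mul_of_nonneg_left hsum hCm
  linarith

/-- **FADING TAILS FROM A MEMORY PROFILE**: configurations agreeing on the first `K` coordinates have `|B u − B v| ≤ Cm·γθ^K∕(1−θ)` (the geometric tail of the profile).
[folklore] -/
theorem tail_of_memoryProfile {B : (ℕ → ℝ) → ℝ} {Cm θ γ : ℝ} (hB : MemoryProfile Cm θ γ B) (hCm : 0 ≤ Cm) (hθ0 : 0 ≤ θ) (hθ1 : θ < 1)
    (hγ : 0 < γ) (K : ℕ) :
    ∀ u v : ℕ → ℝ, SeqBox γ u → SeqBox γ v → (∀ k, k < K → u k = v k) → |B u - B v| ≤ Cm * (γ * θ ^ K / (1 - θ)) := by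
  intro u v hu hv hagree
  have hprof := hB u v hu hv
  -- majorant g k = if k < K then 0 else γ θ^k
  set g : ℕ → ℝ := fun k => if k < K then 0 else γ * θ ^ k with hg
  have hterm : ∀ k, θ ^ k * |u k - v k| ≤ g k := by
    intro k
    by_cases hk : k < K
    · rw [hg]; simp only [if_pos hk, hagree k hk, sub_self, abs_zero, mul_zero]; exact le_rfl
    · rw [hg]; simp only [if_neg hk]
      have : |u k - v k| ≤ γ := by
        rw [abs_le]; constructor <;> linarith [(hu k).1, (hu k).2, (hv k).1, (hv k).2]
      nlinarith [pow_nonneg hθ0 k]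
  have hgeo : Summable (fun k : ℕ => θ ^ k) := summable_geometric_of_lt_one hθ0 hθ1
  have hg_le : ∀ k, g k ≤ γ * θ ^ k := fun k => by
    rw [hg]; dsimp only; split_ifs <;> nlinarith [pow_nonneg hθ0 k, hγ]
  have hg0 : ∀ k, 0 ≤ g k := fun k => by rw [hg]; dsimp only; split_ifs <;> nlinarith [pow_nonneg hθ0 k, hγ]
  have hgs : Summable g := Summable.of_nonneg_of_le hg0 hg_le (hgeo.mul_left γ)
  have hle : ∑' k, θ ^ k * |u k - v k| ≤ ∑' k, g k :=
    Summable.tsum_le_tsum hterm (summable_profile hθ0 hθ1 hu hv) hgs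
  -- evaluate Σ' g = γ θ^K Σ' θ^i
  have hsplit := hgs.sum_add_tsum_nat_add K
  have hzero : ∑ i ∈ range K, g i = 0 := sum_eq_zero fun i hi => by
    rw [hg]; simp [Finset.mem_range.mp hi]
  have hshift : ∀ i, g (i + K) = γ * θ ^ K * θ ^ i := fun i => by
    rw [hg]; simp only [if_neg (by omega : ¬ (i + K < K)), pow_add]; ring
  have htail : ∑' i, g (i + K) = γ * θ ^ K * (1 - θ)⁻¹ := by
    simp_rw [hshift]
    rw [tsum_mul_left, tsum_geometric_of_lt_one hθ0 hθ1]
  rw [hzero, zero_add, htail] at hsplit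
  have : ∑' k, g k = γ * θ ^ K / (1 - θ) := by rw [← hsplit, div_eq_mul_inv]
  rw [this] at hle
  exact hprof.trans (mul_le_mul_of_nonneg_left hle hCm)

/-- The partial FIRST age moments of the geometric profile are bounded: `Σ_{k<K} k·θ^k ≤ θ∕(1−θ)²` (Mathlib's `tsum_coe_mul_geometric_of_norm_lt_one`). [folklore] -/
theorem partial_first_moment_le {θ : ℝ} (hθ0 : 0 ≤ θ) (hθ1 : θ < 1) (K : ℕ) :
    ∑ k ∈ range K, (k : ℝ) * θ ^ k ≤ θ / (1 - θ) ^ 2 := by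
  have hnorm : ‖θ‖ < 1 := by rw [Real.norm_eq_abs, abs_of_nonneg hθ0]; exact hθ1
  have hs : Summable (fun n : ℕ => (n : ℝ) * θ ^ n) := by
    have := summable_pow_mul_geometric_of_norm_lt_one 1 hnorm
    simpa using this
  rw [← tsum_coe_mul_geometric_of_norm_lt_one hnorm]
  exact hs.sum_le_tsum (range K) fun n _ => mul_nonneg (Nat.cast_nonneg n) (pow_nonneg hθ0 n)

/-- The partial SECOND age moments are bounded by the (finite) number `Σ' k, k²θ^k` (`= θ(1+θ)∕(1−θ)³`, not evaluated here; `Σ_{l<k}(l+1) = k(k+1)∕2 ≤ k²`). [folklore] -/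
theorem partial_second_moment_le {θ : ℝ} (hθ0 : 0 ≤ θ) (hθ1 : θ < 1) (K : ℕ) :
    ∑ k ∈ range K, θ ^ k * ∑ l ∈ range k, ((l : ℝ) + 1) ≤ ∑' k : ℕ, (k : ℝ) ^ 2 * θ ^ k := by
  have hnorm : ‖θ‖ < 1 := by rw [Real.norm_eq_abs, abs_of_nonneg hθ0]; exact hθ1
  have hs : Summable (fun n : ℕ => (n : ℝ) ^ 2 * θ ^ n) := by
    have := summable_pow_mul_geometric_of_norm_lt_one 2 hnorm
    simpa using this
  have hinner : ∀ k : ℕ, ∑ l ∈ range k, ((l : ℝ) + 1) ≤ (k : ℝ) ^ 2 := by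
    intro k
    have h1 : ∑ l ∈ range k, ((l : ℝ) + 1) ≤ ∑ l ∈ range k, (k : ℝ) :=
      sum_le_sum fun l hl => by
        have hlk : l + 1 ≤ k := Nat.succ_le_of_lt (Finset.mem_range.mp hl)
        exact_mod_cast hlk
    rw [sum_const, card_range, nsmul_eq_mul] at h1
    nlinarith
  calc ∑ k ∈ range K, θ ^ k * ∑ l ∈ range k, ((l : ℝ) + 1) ≤ ∑ k ∈ range K, (k : ℝ) ^ 2 * θ ^ k :=
        sum_le_sum fun k _ => by rw [mul_comm]; exact mul_le_mul_of_nonneg_right (hinner k) (pow_nonneg hθ0 k)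
    _ ≤ ∑' k : ℕ, (k : ℝ) ^ 2 * θ ^ k := hs.sum_le_tsum (range K) fun n _ => mul_nonneg (sq_nonneg _) (pow_nonneg hθ0 n)


/-! ## §2 The enclosure under node U2's memory profile -/

variable {B B' : (ℕ → ℝ) → ℝ} {γ b : ℝ} {h' hlo hup : ℕ → ℝ}

/-- **ENCLOSURE UNDER A MEMORY PROFILE.**  `B`: ISOTONE on the box `]0,γ]^ℕ` (`γ > 0`) with node U2's `MemoryProfile Cm θ γ B` (`Cm ≥ 0`, `0 ≤ θ < 1`), floor `b ≤ B` and
ceiling `B ≤ β̄`; the LEVEL age moment of its geometric level profile below one: **`θ_lev := Cm·γ³·θ∕(1−θ)² < 1`**; second moment constant `θ₂ := Cm·γ³·Σ' k, k²θ^k`.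
`B′`: ANY functional with `|B′ u − B u| ≤ ε` on the box, `0 ≤ ε < b`.  `h₋, h₊, h′`: ANY box solutions of `B − ε`, `B + ε`, `B′` from one pin `p`.  Then at EVERY scale `j`:
**`1∕h₋_j² − θ₂·(2ε + θ_lev·2ε∕(1−θ_lev)) ≤ 1∕h′_j² ≤ 1∕h₊_j² + θ₂·(2ε + θ_lev·2ε∕(1−θ_lev))`** — (E140n) `enclosure_infinite` with (W), (T), the zeroth moment and the
partial age moments all read off the memory profile. [folklore] -/
theorem enclosure_memoryProfile {Cm θ βb p ε : ℝ}
    (hprof : MemoryProfile Cm θ γ B) (hCm : 0 ≤ Cm) (hθ0 : 0 ≤ θ) (hθ1 : θ < 1) (hγ : 0 < γ)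
    (hmono : ∀ u v : ℕ → ℝ, SeqBox γ u → SeqBox γ v → (∀ i, u i ≤ v i) → B u ≤ B v)
    (hlow : ∀ u, SeqBox γ u → b ≤ B u) (hbdd : ∀ u, SeqBox γ u → B u ≤ βb)
    (hε : 0 ≤ ε) (hεb : ε < b) (hsmall : Cm * γ ^ 3 * (θ / (1 - θ) ^ 2) < 1)
    (hpert : ∀ u, SeqBox γ u → |B' u - B u| ≤ ε)
    (hp : 0 < p) (hpγ : p ≤ γ) (hhlo : SeqBox γ hlo) (hflo : MemFlow (fun w => B w + -ε) p hlo)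
    (hhup : SeqBox γ hup) (hfup : MemFlow (fun w => B w + ε) p hup) (hh' : SeqBox γ h') (hf' : MemFlow B' p h') (j : ℕ) :
    1 / hlo j ^ 2 - (Cm * γ ^ 3 * ∑' k : ℕ, (k : ℝ) ^ 2 * θ ^ k)
          * (2 * ε + (Cm * γ ^ 3 * (θ / (1 - θ) ^ 2)) * (2 * ε) / (1 - Cm * γ ^ 3 * (θ / (1 - θ) ^ 2))) ≤ 1 / h' j ^ 2
      ∧ 1 / h' j ^ 2 ≤ 1 / hup j ^ 2 + (Cm * γ ^ 3 * ∑' k : ℕ, (k : ℝ) ^ 2 * θ ^ k)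
          * (2 * ε + (Cm * γ ^ 3 * (θ / (1 - θ) ^ 2)) * (2 * ε) / (1 - Cm * γ ^ 3 * (θ / (1 - θ) ^ 2))) := by
  have hCγ : 0 ≤ Cm * γ ^ 3 := mul_nonneg hCm (pow_nonneg hγ.le 3)
  -- zeroth moment (β-flow team, part 38, BY NAME)
  have hzm := zerothMoment_of_memoryProfile hprof hCm hθ0 hθ1
  have hM : 0 ≤ Cm / (1 - θ) := div_nonneg hCm (by linarith)
  -- the geometric level profile and its partial moments
  have hΛ : ∀ k, 0 ≤ Cm * γ ^ 3 * θ ^ k := fun k => mul_nonneg hCγ (pow_nonneg hθ0 k)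
  have hS1 : ∀ K : ℕ, ∑ k ∈ range K, (k : ℝ) * (Cm * γ ^ 3 * θ ^ k) ≤ Cm * γ ^ 3 * (θ / (1 - θ) ^ 2) := by
    intro K
    have e : ∑ k ∈ range K, (k : ℝ) * (Cm * γ ^ 3 * θ ^ k) = Cm * γ ^ 3 * ∑ k ∈ range K, (k : ℝ) * θ ^ k := by
      rw [mul_sum]; exact sum_congr rfl fun k _ => by ring
    rw [e]
    exact mul_le_mul_of_nonneg_left (partial_first_moment_le hθ0 hθ1 K) hCγ
  have hS2 : ∀ K : ℕ, ∑ k ∈ range K, (Cm * γ ^ 3 * θ ^ k) * ∑ l ∈ range k, ((l : ℝ) + 1) ≤ Cm * γ ^ 3 * ∑' k : ℕ, (k : ℝ) ^ 2 * θ ^ k := by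
    intro K
    have e : ∑ k ∈ range K, (Cm * γ ^ 3 * θ ^ k) * ∑ l ∈ range k, ((l : ℝ) + 1) = Cm * γ ^ 3 * ∑ k ∈ range K, θ ^ k * ∑ l ∈ range k, ((l : ℝ) + 1) := by
      rw [mul_sum]; exact sum_congr rfl fun k _ => by ring
    rw [e]
    exact mul_le_mul_of_nonneg_left (partial_second_moment_le hθ0 hθ1 K) hCγ
  -- window profiles and tails
  have hwin : ∀ K : ℕ, ∀ u v : ℕ → ℝ, SeqBox γ u → SeqBox γ v → (∀ k : ℕ, k < K → 1 / γ ^ 2 + ((k : ℝ) + 1) * ((b - ε) / 2) ≤ 1 / u k ^ 2) →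
      (∀ k : ℕ, k < K → 1 / γ ^ 2 + ((k : ℝ) + 1) * ((b - ε) / 2) ≤ 1 / v k ^ 2) → (∀ k : ℕ, K ≤ k → u k = v k) →
      B u - B v ≤ ∑ k ∈ range K, (Cm * γ ^ 3 * θ ^ k) * max (1 / v k ^ 2 - 1 / u k ^ 2) 0 :=
    fun K u v hu hv _ _ hagree => window_profile_of_memoryProfile hprof hCm hθ0 hγ hmono K u v hu hv hagree
  have htail : ∀ K : ℕ, ∀ u v : ℕ → ℝ, SeqBox γ u → SeqBox γ v → (∀ k : ℕ, k < K → u k = v k) →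
      |B u - B v| ≤ (fun K : ℕ => Cm * (γ * θ ^ K / (1 - θ))) K :=
    fun K u v hu hv hagree => tail_of_memoryProfile hprof hCm hθ0 hθ1 hγ K u v hu hv hagree
  have hηlim : Tendsto (fun K : ℕ => Cm * (γ * θ ^ K / (1 - θ))) atTop (𝓝 0) := by
    have h1 : Tendsto (fun K : ℕ => θ ^ K) atTop (𝓝 0) := tendsto_pow_atTop_nhds_zero_of_lt_one hθ0 hθ1
    have h2 : Tendsto (fun K : ℕ => Cm * (γ * θ ^ K / (1 - θ))) atTop (𝓝 (Cm * (γ * 0 / (1 - θ)))) :=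
      ((h1.const_mul γ).div_const (1 - θ)).const_mul Cm
    rw [mul_zero, zero_div, mul_zero] at h2
    exact h2
  have hb₀ : 0 < (b - ε) / 2 := by linarith
  have hfit : (b - ε) / 2 + ε < b := by linarith
  exact enclosure_infinite (Λ := fun k => Cm * γ ^ 3 * θ ^ k) (η := fun K : ℕ => Cm * (γ * θ ^ K / (1 - θ)))
    hmono hzm hM hε hb₀ hfit hlow hbdd hΛ hS1 hsmall hS2 hwin htail hηlim hpert hp hpγ hhlo hflo hhup hfup hh' hf' j

end Summit.QuantumFields.BalabanUV.Beta.EriceRemainderEnclosureHistoryAutonomyComparisonDefectMemoryProfile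

end
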